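import Literature.MathematicalPhysics.QuantumFieldTheory.Balaban1983to89.B9SectBGWordDeltaAY
import Literature.MathematicalPhysics.QuantumFieldTheory.Balaban1983to89.B9SectBGWordDiffY
import Literature.MathematicalPhysics.QuantumFieldTheory.Balaban1983to89.B9SectBGReadY

/-!
# Balaban [B9], Thm 3.3 p. 399 with (3.42) p. 397, Thm 3.4 p. 400, [4] (2.51) p. 232 — THE (3.42) READ ∕ WRITE FIELDS OF THE ROW-13 G FRAME AT
# NODE 00's LETTERS: gen 12's `B9SectBGReadY.readG342Y_KACU ∕ writeG342Y_KACU` (bond carrier `FBondY × ι`) TRANSPORTED to r06's carrier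
# `(κ × SiteY) × ι` and r06's difference letters `diffLetter (bT shiftY) (bU V) η⁻¹ k` — ★★ `readG342_GbC`, ★★ `writeG342_GbC`
# (pub-ymgap N06 G-side plan, Route L, L-5: the fields `readG342 ∕ writeG342` of `B9SectBGFrameV4.GFrame₄` for the instance `gFrame₄CodedOn`)

T. Bałaban, *Propagators for lattice gauge theories in a background field*, Commun. Math. Phys. **99** (1985) 389–434
[`Balaban1985BackgroundPropagators`, "B9"]; [4] = T. Bałaban, *Propagators and renormalization transformations for lattice gauge
theories. II*, Commun. Math. Phys. **96** (1984) 223–250 [`Balaban1984PropagatorsII`].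

statement-level skeleton of published theorems with citation tags; proofs where landed; nothing here is a claim about the
Yang–Mills mass gap

THE PRINTED LOCI.  (3.42) p. 397 (the four entries `G`, `∇_UG`, `G∇*_U`, `Δ_UG` of Theorem 3.3 p. 399); Theorem 3.4 p. 400; [4] (2.51) p. 232 (block majorants).

WHY THIS FILE (seat dag-n06-c gen 13).  The G frame reads the (3.42) block of the family `GA` at a regular base into block majorants of its four bond letters
`Gb U`, `conj b (diffLetter (bT T) (bU (coord U)) η⁻¹ k) * Gb U`, `Gb U * conj b (diffLetter … k)`, `LapB U * Gb U` on the carrier `(κ × S) × ι` with the block map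
`blk ∘ snd ∘ fst` (field `readG342`), and writes such majorants at a class product back into the (3.42) block (field `writeG342`).  Gen 12 proved both
dictionaries for NODE 00's coded bond reading `KACU G x OA parB C37 C38` on def-Y's own carrier `FBondY × ι` with the block map `ι_B ∘ blkV1 ∘ fst` and def-Y's
letters `cdBₗ ∕ cdsBₗ ∕ lapBₗ` (`B9SectBGReadY`).  THIS FILE moves them: §1 a block-majorant transport along a reindexing of the carrier (`hasMajorant_reindex`,
`hasMajorant_neg_iff`); §2 the bond reindexing `bondReindexY` (def-Y's `bondCoordsY × id`), its block compatibility (`blkC_bondReindexY`, by `rfl`) and the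
conjugation formula `conj_bondOpCoordsRY_apply`; §3 def-Y's difference letters ARE r06's up to the sign of `c_f` (`bondOpCoordsRY_cdBₗ ∕ _cdsBₗ` from gen 13's
`B9SectBGWordDiffY`, `diffLetter_neg`, `diffLetter_abs_eq`); §4 ★★ `readG342_GbC` and ★★ `writeG342_GbC` — the two fields for the letters `GbC ∕ LapBC` of
`B9SectBGWordDeltaAY` with `OA := GAY parS parB (GpY parS)`, reading constant `c_RG = M₂Σ_j‖b_j‖`, writing function `w_BG(B, δ) = M₂Σ_j‖b_j‖·B + 1`, same rate.

HONEST SCOPE.  Transport of landed dictionaries; no new estimate; nothing of [B9] asserted; count-neutral; N06 NOT discharged; nothing continuum ∕ OS ∕ mass-gap ∕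
Clay.  One definition (`bondReindexY`, an `Equiv`); no `sorry`, no `axiom`, no `instance`, no `notation`.  `--supports stmt-QuantumFields-27364`.

RELATED IN THE TREE, NOT DUPLICATED: `B9SectBGReadY` (gen 12 — USED), `B9SectBGWordDiffY` ∕ `B9SectBGWordDeltaAY` (gen 13 — USED), `B9SectBGpFrameCodedY.read342Y_KSC`
(the G′ twin), `B9SectBGpTransferInY.eBlock_mono`.
-/

noncomputable section

namespace Literature.MathematicalPhysics.QuantumFieldTheory.Balaban1983to89.B9SectBGReadCodedY

open Literature.MathematicalPhysics.QuantumFieldTheory.Balaban1983to89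
open Literature.MathematicalPhysics.QuantumFieldTheory.Balaban1983to89.Node00 (SiteY BlkY FBondY IBondY CfgY SiteParY BondParY UboxY shiftY cdB cdsB GAY GpY
  bondCoordsY bondFunCoordsY bondFunCoordsY_apply bondCoordsY_apply bondCoordsY_symm_mk)
open Literature.MathematicalPhysics.QuantumFieldTheory.Balaban1983to89.B6GlobalChartV1 (blkV1)
open Literature.MathematicalPhysics.QuantumFieldTheory.Balaban1983to89.B6Ineq2142KLevelV1 (β)
open Literature.MathematicalPhysics.QuantumFieldTheory.Balaban1983to89.B6KLevelCensusIndexV1 (KIdx kGeo)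
open Literature.MathematicalPhysics.QuantumFieldTheory.Balaban1983to89.B6RandomWalk (HasMajorant BlockSupp hasMajorant_mono)
open Literature.MathematicalPhysics.QuantumFieldTheory.Balaban1983to89.B9Thm34Ext (toB6)
open Literature.MathematicalPhysics.QuantumFieldTheory.Balaban1983to89.B9FromB6 (EBlock)
open Literature.MathematicalPhysics.QuantumFieldTheory.Balaban1983to89.B9GeoNormsKLevelV1 (geo9K)
open Literature.MathematicalPhysics.QuantumFieldTheory.Balaban1983to89.B9Eq352DivFormLetters (conj coordEquiv conj_apply conj_neg gradLetterF_apply gradLetterB_apply)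
open Literature.MathematicalPhysics.QuantumFieldTheory.Balaban1983to89.B9Eq352GradLetters (diffLetter diffLetter_inl diffLetter_inr)
open Literature.MathematicalPhysics.QuantumFieldTheory.Balaban1983to89.B9Eq371GradLetters (bT bU)
open Literature.MathematicalPhysics.QuantumFieldTheory.Balaban1983to89.B9CoReadingCoords (cdBₗ cdsBₗ lapBₗ cdBₗ_apply cdsBₗ_apply lapBₗ_apply)
open Literature.MathematicalPhysics.QuantumFieldTheory.Balaban1983to89.B9PinMembersKLevelV1 (MemberY geo9Y bg9Y)
open Literature.MathematicalPhysics.QuantumFieldTheory.Balaban1983to89.B9Eq360DeltaPrimeAY (AfldY)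
open Literature.MathematicalPhysics.QuantumFieldTheory.Balaban1983to89.B9SectBGpFrameCodedY (codingYx)
open Literature.MathematicalPhysics.QuantumFieldTheory.Balaban1983to89.B9SectBGpLettersY (GVal decY decY_base decY_prod coordC blkC)
open Literature.MathematicalPhysics.QuantumFieldTheory.Balaban1983to89.B9SectBL2DictionaryY (coordC_base_eq)
open Literature.MathematicalPhysics.QuantumFieldTheory.Balaban1983to89.B9SectBCodedCarrier (CCfg)
open Literature.MathematicalPhysics.QuantumFieldTheory.Balaban1983to89.B9SectBCodedReadingsU (KACU)
open Literature.MathematicalPhysics.QuantumFieldTheory.Balaban1983to89.B9SectBGReadY (readG342Y_KACU writeG342Y_KACU)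
open Literature.MathematicalPhysics.QuantumFieldTheory.Balaban1983to89.B9SectBGpTransferInY (eBlock_mono)
open Literature.MathematicalPhysics.QuantumFieldTheory.Balaban1983to89.B9SectBGWordDiffY (bondFunCoordsY_cdB bondFunCoordsY_cdsB_inr)
open Literature.MathematicalPhysics.QuantumFieldTheory.Balaban1983to89.B9SectBGWordDeltaAY (bondOpCoordsRY bondOpCoordsRY_apply restrictScalars_bondOpCoordsY GbC LapBC
  restrictScalars_mul')

variable {d ℓ : ℕ} {hd : 1 ≤ d + 1} {hL : Odd (ℓ + 1) ∧ 1 < ℓ + 1} {b₀ b₁ : ℝ}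
variable {𝔸 : Type} [NormedRing 𝔸] [NormedAlgebra ℂ 𝔸] [CompleteSpace 𝔸]
variable {ι : Type} [Fintype ι]

/-! ## §1 Block majorants along a reindexing of the carrier -/

section Reindex

variable {g : B6.Geometry} {X X' : Type}

/-- ★ a block majorant is transported along a reindexing `e : X ≃ X′` compatible with the block maps: if `T′ μ′ x′ = T (μ′ ∘ e) (e⁻¹ x′)` then
`HasMajorant blk T K → HasMajorant blk′ T′ K`. [cite: Balaban1984PropagatorsII, (2.51) p.232, bookkeeping] -/
theorem hasMajorant_reindex (e : X ≃ X') {blk : X → g.Site} {blk' : X' → g.Site} (hblk : ∀ x, blk' (e x) = blk x)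
    (T : Module.End ℝ (X → ℝ)) (T' : Module.End ℝ (X' → ℝ)) (hT : ∀ (μ' : X' → ℝ) (x' : X'), T' μ' x' = T (μ' ∘ e) (e.symm x'))
    {K : g.Site → g.Site → ℝ} (h : HasMajorant blk T K) : HasMajorant blk' T' K := by
  intro y' μ' B hμ' x'
  have hμ : BlockSupp blk (μ' ∘ e) y' B :=
    { nonneg := hμ'.nonneg
      bound := fun x hx => hμ'.bound (e x) (by rw [hblk]; exact hx)
      off := fun x hx => hμ'.off (e x) (by rw [hblk]; exact hx) }
  have h1 := h y' (μ' ∘ e) B hμ (e.symm x')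
  rw [← hblk (e.symm x'), Equiv.apply_symm_apply] at h1
  rw [hT]
  exact h1

/-- a block majorant is blind to the sign of the operator. [cite: Balaban1984PropagatorsII, (2.51) p.232, bookkeeping] -/
theorem hasMajorant_neg_iff {blk : X → g.Site} (T : Module.End ℝ (X → ℝ)) {K : g.Site → g.Site → ℝ} :
    HasMajorant blk (-T) K ↔ HasMajorant blk T K := by
  constructor <;> intro h y' μ B hμ x <;> have h1 := h y' μ B hμ x <;>
    simpa only [LinearMap.neg_apply, Pi.neg_apply, abs_neg] using h1

end Reindex

/-! ## §2 The bond reindexing `FBondY × ι ≃ (κ × SiteY) × ι` and the conjugation formula -/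

section Bond

variable (i : KIdx d ℓ hd hL b₀ b₁) (b : Module.Basis ι ℝ 𝔸)

omit [Fintype ι] in
/-- the reindexing of the real bond carrier: def-Y's `bondCoordsY` on the bond, the identity on the basis index.
[cite: Balaban1985BackgroundPropagators, (3.1) p.390, dictionary] -/
def bondReindexY : (FBondY i × ι) ≃ ((Fin (d + 1) × SiteY i) × ι) := (bondCoordsY i).prodCongr (Equiv.refl ι)

omit [Fintype ι] in
/-- `bondReindexY` on a pair. [cite: Balaban1985BackgroundPropagators, (3.1) p.390, dictionary] -/
@[simp] theorem bondReindexY_apply (p : FBondY i × ι) : bondReindexY (ι := ι) i p = (bondCoordsY i p.1, p.2) := rfl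

omit [Fintype ι] in
/-- `bondReindexY⁻¹` on a pair. [cite: Balaban1985BackgroundPropagators, (3.1) p.390, dictionary] -/
@[simp] theorem bondReindexY_symm_apply (q : (Fin (d + 1) × SiteY i) × ι) : (bondReindexY (ι := ι) i).symm q = ((bondCoordsY i).symm q.1, q.2) := rfl

omit [Fintype ι] in
/-- ★ BLOCK COMPATIBILITY (`rfl`): r06's block map `blkC ι_B ∘ snd ∘ fst` on `(κ × SiteY) × ι` pulled back along `bondReindexY` IS gen 12's `ι_B ∘ blkV1 ∘ fst` on
`FBondY × ι` (both: the 𝔅-block of the bond's initial point, labelled through `ι_B`). [cite: Balaban1984PropagatorsII, (2.45)–(2.46) p.231, bookkeeping] -/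
theorem blkC_bondReindexY (ιB : BlkY i → IBondY i) (p : FBondY i × ι) :
    blkC i ιB (bondReindexY (ι := ι) i p).1.2 = ιB (blkV1 i.hN i.D p.1) := rfl

omit [CompleteSpace 𝔸] in
/-- ★ THE CONJUGATION FORMULA: `conj b (bondOpCoordsRY T) μ′ q = conj b T (μ′ ∘ bondReindexY) (bondReindexY⁻¹ q)`.
[cite: Balaban1984PropagatorsII, (2.51) p.232; Balaban1985BackgroundPropagators, (3.1) p.390, bookkeeping] -/
theorem conj_bondOpCoordsRY_apply (T : Module.End ℝ (FBondY i → 𝔸)) (μ' : (Fin (d + 1) × SiteY i) × ι → ℝ) (q : (Fin (d + 1) × SiteY i) × ι) :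
    conj b (bondOpCoordsRY i T) μ' q = conj b T (μ' ∘ bondReindexY (ι := ι) i) ((bondReindexY (ι := ι) i).symm q) := by
  rw [conj_apply, conj_apply, bondOpCoordsRY_apply, bondFunCoordsY_apply, bondReindexY_symm_apply]
  congr 3

variable {Rr : ℝ} {Hp : Prop} [Fintype (geo9K i).Site]

omit [CompleteSpace 𝔸] in
/-- ★ TRANSPORT, def-Y's carrier → r06's: a block majorant of `conj b T` on `FBondY × ι` (block map `ι_B ∘ blkV1 ∘ fst`) IS one of `conj b (bondOpCoordsRY T)` on
`(κ × SiteY) × ι` (block map `blkC ι_B ∘ snd ∘ fst`), same kernel. [cite: Balaban1984PropagatorsII, (2.51) p.232, bookkeeping] -/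
theorem hasMajorant_conj_bondOpCoordsRY (ιB : BlkY i → IBondY i) (T : Module.End ℝ (FBondY i → 𝔸)) {K : IBondY i → IBondY i → ℝ}
    (h : HasMajorant (g := toB6 (geo9K i) Rr Hp) (fun p : FBondY i × ι => ιB (blkV1 i.hN i.D p.1)) (conj b T) K) :
    HasMajorant (g := toB6 (geo9K i) Rr Hp) (fun q : (Fin (d + 1) × SiteY i) × ι => blkC i ιB q.1.2) (conj b (bondOpCoordsRY i T)) K :=
  hasMajorant_reindex (bondReindexY (ι := ι) i) (fun p => blkC_bondReindexY (ι := ι) i ιB p) _ _ (conj_bondOpCoordsRY_apply i b T) h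

omit [CompleteSpace 𝔸] in
/-- ★ TRANSPORT, r06's carrier → def-Y's. [cite: Balaban1984PropagatorsII, (2.51) p.232, bookkeeping] -/
theorem hasMajorant_conj_of_bondOpCoordsRY (ιB : BlkY i → IBondY i) (T : Module.End ℝ (FBondY i → 𝔸)) {K : IBondY i → IBondY i → ℝ}
    (h : HasMajorant (g := toB6 (geo9K i) Rr Hp) (fun q : (Fin (d + 1) × SiteY i) × ι => blkC i ιB q.1.2) (conj b (bondOpCoordsRY i T)) K) :
    HasMajorant (g := toB6 (geo9K i) Rr Hp) (fun p : FBondY i × ι => ιB (blkV1 i.hN i.D p.1)) (conj b T) K := by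
  refine hasMajorant_reindex (bondReindexY (ι := ι) i).symm (blk := fun q : (Fin (d + 1) × SiteY i) × ι => blkC i ιB q.1.2) (fun q => ?_) _ _
    (fun μ p => ?_) h
  · rw [← blkC_bondReindexY (ι := ι) i ιB, Equiv.apply_symm_apply]
  · rw [conj_bondOpCoordsRY_apply, Equiv.symm_symm]
    simp only [Function.comp_def, Equiv.symm_apply_apply]

end Bond

/-! ## §3 def-Y's difference letters ARE r06's, up to the sign of `c_f` -/

section Letters

variable (i : KIdx d ℓ hd hL b₀ b₁)

omit [CompleteSpace 𝔸] in
/-- `bondOpCoordsRY` is multiplicative. [cite: Balaban1985BackgroundPropagators, (3.4)–(3.9) pp.391–392, folklore] -/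
theorem bondOpCoordsRY_mul (f g : Module.End ℝ (FBondY i → 𝔸)) : bondOpCoordsRY i (f * g) = bondOpCoordsRY i f * bondOpCoordsRY i g := by
  simp only [bondOpCoordsRY, Module.End.mul_eq_comp, LinearEquiv.conj_comp]

/-- ★ `∇_{U,ν}` on the bond sector in r06's letters: `bondOpCoordsRY (cdBₗ U ν) = diffLetter (bT shiftY) (bU (UboxY U)) c_f (inl ν)`.
[cite: Balaban1985BackgroundPropagators, (3.3) p.390, (3.42) p.397] -/
theorem bondOpCoordsRY_cdBₗ (U : CfgY 𝔸 i) (ν : Fin (d + 1)) :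
    bondOpCoordsRY i (cdBₗ i U ν) = diffLetter (bT (shiftY i)) (bU (UboxY i U)) ((i.cf : ℝ) : ℂ) (Sum.inl ν) := by
  refine LinearMap.ext fun F => ?_
  rw [bondOpCoordsRY_apply]
  have h := bondFunCoordsY_cdB i U ν ((bondFunCoordsY i).symm F)
  rw [LinearEquiv.apply_symm_apply] at h
  rw [← h]
  rfl

/-- ★ `∇*_{U,ν}` on the bond sector in r06's letters: `bondOpCoordsRY (cdsBₗ U ν) = −diffLetter (bT shiftY) (bU (UboxY U)) c_f (inr ν)`.
[cite: Balaban1985BackgroundPropagators, (3.8) p.392, (3.42) p.397] -/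
theorem bondOpCoordsRY_cdsBₗ (U : CfgY 𝔸 i) (ν : Fin (d + 1)) :
    bondOpCoordsRY i (cdsBₗ i U ν) = -diffLetter (bT (shiftY i)) (bU (UboxY i U)) ((i.cf : ℝ) : ℂ) (Sum.inr ν) := by
  refine LinearMap.ext fun F => ?_
  rw [bondOpCoordsRY_apply, LinearMap.neg_apply]
  have h := bondFunCoordsY_cdsB_inr i U ν ((bondFunCoordsY i).symm F)
  rw [LinearEquiv.apply_symm_apply] at h
  rw [← h]
  rfl

omit [CompleteSpace 𝔸] in
/-- `diffLetter T V (−c) k = −diffLetter T V c k`. [cite: Balaban1985BackgroundPropagators, (3.3) p.390, (3.8) p.392, bookkeeping] -/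
theorem diffLetter_neg {κ S : Type} (T : κ → S ≃ S) (V : κ → S → 𝔸ˣ) (c : ℂ) (k : κ ⊕ κ) : diffLetter T V (-c) k = -diffLetter T V c k := by
  cases k with
  | inl μ =>
    refine LinearMap.ext fun f => funext fun x => ?_
    simp only [diffLetter_inl, gradLetterF_apply, LinearMap.neg_apply, Pi.neg_apply, neg_smul]
  | inr μ =>
    refine LinearMap.ext fun f => funext fun x => ?_
    simp only [diffLetter_inr, gradLetterB_apply, LinearMap.neg_apply, Pi.neg_apply, neg_smul, neg_neg]

omit [CompleteSpace 𝔸] in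
/-- the letter with the constant `|c|` is `±` the letter with `c`. [cite: Balaban1985BackgroundPropagators, (3.3) p.390, bookkeeping] -/
theorem diffLetter_abs_eq {κ S : Type} (T : κ → S ≃ S) (V : κ → S → 𝔸ˣ) (c : ℝ) (k : κ ⊕ κ) :
    diffLetter T V ((|c| : ℝ) : ℂ) k = diffLetter T V ((c : ℝ) : ℂ) k ∨ diffLetter T V ((|c| : ℝ) : ℂ) k = -diffLetter T V ((c : ℝ) : ℂ) k := by
  rcases le_or_gt 0 c with hc | hc
  · exact Or.inl (by rw [abs_of_nonneg hc])
  · exact Or.inr (by rw [abs_of_neg hc, Complex.ofReal_neg, diffLetter_neg])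

/-- the frames' constant: `((kGeo i).eta : ℂ)⁻¹ = |c_f|`. [cite: Balaban1985BackgroundPropagators, (3.1) p.390, bookkeeping] -/
theorem eta_inv_eq_abs_cf : ((((kGeo i).eta : ℝ) : ℂ))⁻¹ = ((|i.cf| : ℝ) : ℂ) := by
  rw [show (kGeo i).eta = |i.cf|⁻¹ from rfl, Complex.ofReal_inv, inv_inv]

variable (b : Module.Basis ι ℝ 𝔸) {Rr : ℝ} {Hp : Prop} [Fintype (geo9K i).Site] (ιB : BlkY i → IBondY i)

omit [CompleteSpace 𝔸] [Fintype ι] in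
/-- transport of a block majorant along an equality of operators. [cite: Balaban1984PropagatorsII, (2.51) p.232, bookkeeping] -/
theorem hasMajorant_of_eq {X : Type} {blk : X → IBondY i} {T T' : Module.End ℝ (X → ℝ)} {K : IBondY i → IBondY i → ℝ} (hTT : T' = T)
    (h : HasMajorant (g := toB6 (geo9K i) Rr Hp) blk T K) : HasMajorant (g := toB6 (geo9K i) Rr Hp) blk T' K := hTT ▸ h

/-- ★ the `∇G` entry: a block majorant of `conj b (cdBₗ U ν ∘ G)` on def-Y's carrier gives one of r06's `conj b (diffLetter … |c_f| (inl ν)) * conj b (bondOpCoordsRY G)`.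
[cite: Balaban1985BackgroundPropagators, (3.42) p.397 (second member); Balaban1984PropagatorsII, (2.51) p.232] -/
theorem hasMajorant_diffLetter_inl_mul (U : CfgY 𝔸 i) (ν : Fin (d + 1)) (G : Module.End ℝ (FBondY i → 𝔸)) {K : IBondY i → IBondY i → ℝ}
    (h : HasMajorant (g := toB6 (geo9K i) Rr Hp) (fun p : FBondY i × ι => ιB (blkV1 i.hN i.D p.1)) (conj b (cdBₗ i U ν ∘ₗ G)) K) :
    HasMajorant (g := toB6 (geo9K i) Rr Hp) (fun q : (Fin (d + 1) × SiteY i) × ι => blkC i ιB q.1.2)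
      (conj b (diffLetter (bT (shiftY i)) (bU (UboxY i U)) ((|i.cf| : ℝ) : ℂ) (Sum.inl ν)) * conj b (bondOpCoordsRY i G)) K := by
  have h1 := hasMajorant_conj_bondOpCoordsRY i b ιB _ h
  have e1 : conj b (bondOpCoordsRY i (cdBₗ i U ν ∘ₗ G)) =
      conj b (diffLetter (bT (shiftY i)) (bU (UboxY i U)) ((i.cf : ℝ) : ℂ) (Sum.inl ν)) * conj b (bondOpCoordsRY i G) := by
    rw [← Module.End.mul_eq_comp, bondOpCoordsRY_mul, B9Eq352DivFormLetters.conj_mul, bondOpCoordsRY_cdBₗ]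
  rcases diffLetter_abs_eq (bT (shiftY i)) (bU (UboxY i U)) i.cf (Sum.inl ν) with h2 | h2
  · exact hasMajorant_of_eq i (by rw [h2, ← e1]) h1
  · exact (hasMajorant_neg_iff _).1 (hasMajorant_of_eq i (by rw [h2, conj_neg, e1]; simp only [Module.End.mul_eq_comp, LinearMap.neg_comp, neg_neg]) h1)

/-- ★ the `G∇*` entry. [cite: Balaban1985BackgroundPropagators, (3.42) p.397 (third member); Balaban1984PropagatorsII, (2.51) p.232] -/
theorem hasMajorant_mul_diffLetter_inr (U : CfgY 𝔸 i) (ν : Fin (d + 1)) (G : Module.End ℝ (FBondY i → 𝔸)) {K : IBondY i → IBondY i → ℝ}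
    (h : HasMajorant (g := toB6 (geo9K i) Rr Hp) (fun p : FBondY i × ι => ιB (blkV1 i.hN i.D p.1)) (conj b (G ∘ₗ cdsBₗ i U ν)) K) :
    HasMajorant (g := toB6 (geo9K i) Rr Hp) (fun q : (Fin (d + 1) × SiteY i) × ι => blkC i ιB q.1.2)
      (conj b (bondOpCoordsRY i G) * conj b (diffLetter (bT (shiftY i)) (bU (UboxY i U)) ((|i.cf| : ℝ) : ℂ) (Sum.inr ν))) K := by
  have h1 := hasMajorant_conj_bondOpCoordsRY i b ιB _ h
  have e1 : conj b (bondOpCoordsRY i (G ∘ₗ cdsBₗ i U ν)) =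
      -(conj b (bondOpCoordsRY i G) * conj b (diffLetter (bT (shiftY i)) (bU (UboxY i U)) ((i.cf : ℝ) : ℂ) (Sum.inr ν))) := by
    rw [← Module.End.mul_eq_comp, bondOpCoordsRY_mul, B9Eq352DivFormLetters.conj_mul, bondOpCoordsRY_cdsBₗ, conj_neg]; simp only [Module.End.mul_eq_comp, LinearMap.comp_neg]
  rcases diffLetter_abs_eq (bT (shiftY i)) (bU (UboxY i U)) i.cf (Sum.inr ν) with h2 | h2
  · exact (hasMajorant_neg_iff _).1 (hasMajorant_of_eq i (by rw [h2, ← e1]) h1)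
  · exact hasMajorant_of_eq i (by rw [h2, conj_neg, e1]; simp only [Module.End.mul_eq_comp, LinearMap.comp_neg]) h1

/-- ★ the CROSS `∇*G` entry (left-backward): a block majorant of `conj b (cdsBₗ U ν ∘ G)` on def-Y's carrier gives one of r06's
`conj b (diffLetter … |c_f| (inr ν)) * conj b (bondOpCoordsRY G)`. [cite: Balaban1985BackgroundPropagators, (3.42) p.397, p.398 l.20–22, (3.8) p.392; Balaban1984PropagatorsII, (2.51) p.232] -/
theorem hasMajorant_diffLetter_inr_mul (U : CfgY 𝔸 i) (ν : Fin (d + 1)) (G : Module.End ℝ (FBondY i → 𝔸)) {K : IBondY i → IBondY i → ℝ}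
    (h : HasMajorant (g := toB6 (geo9K i) Rr Hp) (fun p : FBondY i × ι => ιB (blkV1 i.hN i.D p.1)) (conj b (cdsBₗ i U ν ∘ₗ G)) K) :
    HasMajorant (g := toB6 (geo9K i) Rr Hp) (fun q : (Fin (d + 1) × SiteY i) × ι => blkC i ιB q.1.2)
      (conj b (diffLetter (bT (shiftY i)) (bU (UboxY i U)) ((|i.cf| : ℝ) : ℂ) (Sum.inr ν)) * conj b (bondOpCoordsRY i G)) K := by
  have h1 := hasMajorant_conj_bondOpCoordsRY i b ιB _ h
  have e1 : conj b (bondOpCoordsRY i (cdsBₗ i U ν ∘ₗ G)) =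
      -(conj b (diffLetter (bT (shiftY i)) (bU (UboxY i U)) ((i.cf : ℝ) : ℂ) (Sum.inr ν)) * conj b (bondOpCoordsRY i G)) := by
    rw [← Module.End.mul_eq_comp, bondOpCoordsRY_mul, B9Eq352DivFormLetters.conj_mul, bondOpCoordsRY_cdsBₗ, conj_neg]
    simp only [Module.End.mul_eq_comp, LinearMap.neg_comp]
  rcases diffLetter_abs_eq (bT (shiftY i)) (bU (UboxY i U)) i.cf (Sum.inr ν) with h2 | h2
  · exact (hasMajorant_neg_iff _).1 (hasMajorant_of_eq i (by rw [h2, ← e1]) h1)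
  · exact hasMajorant_of_eq i (by rw [h2, conj_neg, e1]; simp only [Module.End.mul_eq_comp, LinearMap.neg_comp]) h1

/-- ★ the CROSS `G∇` entry (right-forward): a block majorant of `conj b (G ∘ cdBₗ U ν)` on def-Y's carrier gives one of r06's
`conj b (bondOpCoordsRY G) * conj b (diffLetter … |c_f| (inl ν))`. [cite: Balaban1985BackgroundPropagators, (3.42) p.397, p.398 l.20–22, (3.3) p.390; Balaban1984PropagatorsII, (2.51) p.232] -/
theorem hasMajorant_mul_diffLetter_inl (U : CfgY 𝔸 i) (ν : Fin (d + 1)) (G : Module.End ℝ (FBondY i → 𝔸)) {K : IBondY i → IBondY i → ℝ}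
    (h : HasMajorant (g := toB6 (geo9K i) Rr Hp) (fun p : FBondY i × ι => ιB (blkV1 i.hN i.D p.1)) (conj b (G ∘ₗ cdBₗ i U ν)) K) :
    HasMajorant (g := toB6 (geo9K i) Rr Hp) (fun q : (Fin (d + 1) × SiteY i) × ι => blkC i ιB q.1.2)
      (conj b (bondOpCoordsRY i G) * conj b (diffLetter (bT (shiftY i)) (bU (UboxY i U)) ((|i.cf| : ℝ) : ℂ) (Sum.inl ν))) K := by
  have h1 := hasMajorant_conj_bondOpCoordsRY i b ιB _ h
  have e1 : conj b (bondOpCoordsRY i (G ∘ₗ cdBₗ i U ν)) =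
      conj b (bondOpCoordsRY i G) * conj b (diffLetter (bT (shiftY i)) (bU (UboxY i U)) ((i.cf : ℝ) : ℂ) (Sum.inl ν)) := by
    rw [← Module.End.mul_eq_comp, bondOpCoordsRY_mul, B9Eq352DivFormLetters.conj_mul, bondOpCoordsRY_cdBₗ]
  rcases diffLetter_abs_eq (bT (shiftY i)) (bU (UboxY i U)) i.cf (Sum.inl ν) with h2 | h2
  · exact hasMajorant_of_eq i (by rw [h2, ← e1]) h1
  · exact (hasMajorant_neg_iff _).1 (hasMajorant_of_eq i (by rw [h2, conj_neg, e1]; simp only [Module.End.mul_eq_comp, LinearMap.comp_neg, neg_neg]) h1)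

/-- the `∇G` entry, converse direction (for WRITING). [cite: Balaban1985BackgroundPropagators, (3.42) p.397; Balaban1984PropagatorsII, (2.51) p.232] -/
theorem hasMajorant_cdBₗ_comp_of (U : CfgY 𝔸 i) (ν : Fin (d + 1)) (G : Module.End ℝ (FBondY i → 𝔸)) {K : IBondY i → IBondY i → ℝ}
    (h : HasMajorant (g := toB6 (geo9K i) Rr Hp) (fun q : (Fin (d + 1) × SiteY i) × ι => blkC i ιB q.1.2)
      (conj b (diffLetter (bT (shiftY i)) (bU (UboxY i U)) ((|i.cf| : ℝ) : ℂ) (Sum.inl ν)) * conj b (bondOpCoordsRY i G)) K) :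
    HasMajorant (g := toB6 (geo9K i) Rr Hp) (fun p : FBondY i × ι => ιB (blkV1 i.hN i.D p.1)) (conj b (cdBₗ i U ν) * conj b G) K := by
  have e1 : conj b (bondOpCoordsRY i (cdBₗ i U ν * G)) =
      conj b (diffLetter (bT (shiftY i)) (bU (UboxY i U)) ((i.cf : ℝ) : ℂ) (Sum.inl ν)) * conj b (bondOpCoordsRY i G) := by
    rw [bondOpCoordsRY_mul, B9Eq352DivFormLetters.conj_mul, bondOpCoordsRY_cdBₗ]
  have h1 : HasMajorant (g := toB6 (geo9K i) Rr Hp) (fun q : (Fin (d + 1) × SiteY i) × ι => blkC i ιB q.1.2)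
      (conj b (bondOpCoordsRY i (cdBₗ i U ν * G))) K := by
    rcases diffLetter_abs_eq (bT (shiftY i)) (bU (UboxY i U)) i.cf (Sum.inl ν) with h2 | h2
    · exact hasMajorant_of_eq i (by rw [e1, ← h2]) h
    · exact hasMajorant_of_eq i (by rw [e1, ← neg_neg (diffLetter _ _ ((i.cf : ℝ) : ℂ) _), ← h2, conj_neg]; simp only [Module.End.mul_eq_comp, LinearMap.neg_comp]) ((hasMajorant_neg_iff _).2 h)
  have h3 := hasMajorant_conj_of_bondOpCoordsRY i b ιB _ h1
  rw [B9Eq352DivFormLetters.conj_mul] at h3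
  exact h3

/-- the `G∇*` entry, converse direction (for WRITING). [cite: Balaban1985BackgroundPropagators, (3.42) p.397; Balaban1984PropagatorsII, (2.51) p.232] -/
theorem hasMajorant_comp_cdsBₗ_of (U : CfgY 𝔸 i) (ν : Fin (d + 1)) (G : Module.End ℝ (FBondY i → 𝔸)) {K : IBondY i → IBondY i → ℝ}
    (h : HasMajorant (g := toB6 (geo9K i) Rr Hp) (fun q : (Fin (d + 1) × SiteY i) × ι => blkC i ιB q.1.2)
      (conj b (bondOpCoordsRY i G) * conj b (diffLetter (bT (shiftY i)) (bU (UboxY i U)) ((|i.cf| : ℝ) : ℂ) (Sum.inr ν))) K) :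
    HasMajorant (g := toB6 (geo9K i) Rr Hp) (fun p : FBondY i × ι => ιB (blkV1 i.hN i.D p.1)) (conj b G * conj b (cdsBₗ i U ν)) K := by
  have e1 : conj b (bondOpCoordsRY i (G * cdsBₗ i U ν)) =
      -(conj b (bondOpCoordsRY i G) * conj b (diffLetter (bT (shiftY i)) (bU (UboxY i U)) ((i.cf : ℝ) : ℂ) (Sum.inr ν))) := by
    rw [bondOpCoordsRY_mul, B9Eq352DivFormLetters.conj_mul, bondOpCoordsRY_cdsBₗ, conj_neg]; simp only [Module.End.mul_eq_comp, LinearMap.comp_neg]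
  have h1 : HasMajorant (g := toB6 (geo9K i) Rr Hp) (fun q : (Fin (d + 1) × SiteY i) × ι => blkC i ιB q.1.2)
      (conj b (bondOpCoordsRY i (G * cdsBₗ i U ν))) K := by
    rcases diffLetter_abs_eq (bT (shiftY i)) (bU (UboxY i U)) i.cf (Sum.inr ν) with h2 | h2
    · exact hasMajorant_of_eq i (by rw [e1, ← h2]) ((hasMajorant_neg_iff _).2 h)
    · exact hasMajorant_of_eq i (by rw [e1, h2, conj_neg]; simp only [Module.End.mul_eq_comp, LinearMap.comp_neg]) h
  have h3 := hasMajorant_conj_of_bondOpCoordsRY i b ιB _ h1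
  rw [B9Eq352DivFormLetters.conj_mul] at h3
  exact h3

end Letters

/-! ## §4 ★★ The fields `readG342` ∕ `writeG342` of the G frame at the letters `GbC`, `LapBC` -/

section Fields

variable {Mstar : ℕ} (G : Subgroup 𝔸ˣ) (x : MemberY d ℓ hd hL b₀ b₁ Mstar) (parS : SiteParY 𝔸 x.toKIdx) (parB : BondParY 𝔸 x.toKIdx)
  (b : Module.Basis ι ℝ 𝔸) (ιB : BlkY x.toKIdx → IBondY x.toKIdx) (C37 C38 : ℝ → CfgY 𝔸 x.toKIdx → AfldY 𝔸 x.toKIdx → Prop)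
  [Fintype (geo9Y x).Site] {Rr : ℝ} {Hp : Prop}

omit [Fintype (geo9Y x).Site] in
/-- `GbC` at a coded configuration is the transported `ℝ`-twin conjugate of `G(decY c)`. [cite: Balaban1985BackgroundPropagators, (3.27) p.395, bookkeeping] -/
theorem GbC_eq_conj_bondOpCoordsRY (c : CCfg (CfgY 𝔸 x.toKIdx) (AfldY 𝔸 x.toKIdx)) :
    GbC x.toKIdx parS parB b c =
      conj b (bondOpCoordsRY x.toKIdx ((GAY x.toKIdx parS parB (GpY x.toKIdx parS) (decY x.toKIdx c)).restrictScalars ℝ)) := by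
  rw [GbC, restrictScalars_bondOpCoordsY]

/-- ★★ **FIELD `readG342` OF THE G FRAME AT NODE 00's LETTERS** (at a `G`-valued base `U`; the instance destructures the coded (3.35) hypothesis to it):
the (3.42) block of `KACU G x (GAY parS parB (GpY parS)) parB C37 C38` at `base U` with `(B₀, δ)` gives r06's block majorants of `GbC (base U)`, of
`conj b (diffLetter (bT shiftY) (bU (coordC (base U))) η⁻¹ k) * GbC` for the PRINTED `k = inl ν`, of `GbC * conj b (diffLetter … k)` for the PRINTED `k = inr ν`,
and of `LapBC (base U) * GbC (base U)`, on `(κ × SiteY) × ι` with `(M₂Σ_j‖b_j‖·B₀, δ)` and the profiles `ℓ², ℓ, ℓ, 1`.  (The cross products `k = inr ν` on the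
left ∕ `k = inl ν` on the right are NOT print's (3.42) entries; they are supplied separately.)
[cite: Balaban1985BackgroundPropagators, Thm 3.3 p.399 with (3.42) p.397, Thm 3.4 p.400; Balaban1984PropagatorsII, (2.51) p.232] -/
theorem readG342_GbC_printed (hι : ∀ s, β x.toKIdx.hN x.toKIdx.D x.toKIdx.hk (ιB s) = s)
    {M₂ : ℝ} (hM₂ : 0 ≤ M₂) (hrepr : ∀ (v : 𝔸) (j : ι), |b.repr v j| ≤ M₂ * ‖v‖) (U : CfgY 𝔸 x.toKIdx) (hUG : GVal G x.toKIdx U)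
    {B₀ δ : ℝ} (hB₀ : 0 ≤ B₀) (hE : EBlock (KACU G x (GAY x.toKIdx parS parB (GpY x.toKIdx parS)) parB C37 C38) B₀ δ (.base U)) :
    HasMajorant (g := toB6 (geo9Y x) Rr Hp) (fun q : (Fin (d + 1) × SiteY x.toKIdx) × ι => blkC x.toKIdx ιB q.1.2) (GbC x.toKIdx parS parB b (.base U))
        (fun a a' => M₂ * (∑ j, ‖b j‖) * B₀ * (geo9Y x).len a ^ 2 * Real.exp (-(δ * (geo9Y x).dist a a'))) ∧
      (∀ ν : Fin (d + 1), HasMajorant (g := toB6 (geo9Y x) Rr Hp) (fun q : (Fin (d + 1) × SiteY x.toKIdx) × ι => blkC x.toKIdx ιB q.1.2)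
        (conj b (diffLetter (bT (shiftY x.toKIdx)) (bU (coordC G x.toKIdx (.base U))) ((((geo9Y x).eta : ℂ))⁻¹) (Sum.inl ν)) *
          GbC x.toKIdx parS parB b (.base U))
        (fun a a' => M₂ * (∑ j, ‖b j‖) * B₀ * (geo9Y x).len a * Real.exp (-(δ * (geo9Y x).dist a a')))) ∧
      (∀ ν : Fin (d + 1), HasMajorant (g := toB6 (geo9Y x) Rr Hp) (fun q : (Fin (d + 1) × SiteY x.toKIdx) × ι => blkC x.toKIdx ιB q.1.2)
        (GbC x.toKIdx parS parB b (.base U) *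
          conj b (diffLetter (bT (shiftY x.toKIdx)) (bU (coordC G x.toKIdx (.base U))) ((((geo9Y x).eta : ℂ))⁻¹) (Sum.inr ν)))
        (fun a a' => M₂ * (∑ j, ‖b j‖) * B₀ * (geo9Y x).len a * Real.exp (-(δ * (geo9Y x).dist a a')))) ∧
      HasMajorant (g := toB6 (geo9Y x) Rr Hp) (fun q : (Fin (d + 1) × SiteY x.toKIdx) × ι => blkC x.toKIdx ιB q.1.2)
        (LapBC x.toKIdx b (.base U) * GbC x.toKIdx parS parB b (.base U))
        (fun a a' => M₂ * (∑ j, ‖b j‖) * B₀ * 1 * Real.exp (-(δ * (geo9Y x).dist a a'))) := by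
  letI : Fintype (geo9K x.toKIdx).Site := ‹Fintype (geo9Y x).Site›
  obtain ⟨h0, h1, h2, h3⟩ := readG342Y_KACU (Rr := Rr) (Hp := Hp) b G x (GAY x.toKIdx parS parB (GpY x.toKIdx parS)) parB C37 C38 ιB hι hM₂ hrepr hB₀ hE
  have hco : coordC G x.toKIdx (.base U) = UboxY x.toKIdx U := coordC_base_eq G x hUG
  have hη : ((((geo9Y x).eta : ℂ)))⁻¹ = ((|x.toKIdx.cf| : ℝ) : ℂ) := eta_inv_eq_abs_cf x.toKIdx
  have hGb := GbC_eq_conj_bondOpCoordsRY x parS parB b (.base U)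
  rw [decY_base] at hGb
  have hK : ∀ (w : IBondY x.toKIdx → ℝ) {T : Module.End ℝ ((Fin (d + 1) × SiteY x.toKIdx) × ι → ℝ)},
      HasMajorant (g := toB6 (geo9Y x) Rr Hp) (fun q : (Fin (d + 1) × SiteY x.toKIdx) × ι => blkC x.toKIdx ιB q.1.2) T
        (fun a a' => M₂ * (∑ j, ‖b j‖) * (B₀ * w a * Real.exp (-(δ * (geo9Y x).dist a a')))) →
      HasMajorant (g := toB6 (geo9Y x) Rr Hp) (fun q : (Fin (d + 1) × SiteY x.toKIdx) × ι => blkC x.toKIdx ιB q.1.2) T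
        (fun a a' => M₂ * (∑ j, ‖b j‖) * B₀ * w a * Real.exp (-(δ * (geo9Y x).dist a a'))) :=
    fun w T h => hasMajorant_mono _ h fun a a' => le_of_eq (by ring)
  refine ⟨?_, fun ν => ?_, fun ν => ?_, ?_⟩
  · exact hK (fun a => (geo9Y x).len a ^ 2) (hasMajorant_of_eq x.toKIdx hGb (hasMajorant_conj_bondOpCoordsRY x.toKIdx b ιB _ h0))
  · refine hK (fun a => (geo9Y x).len a) (hasMajorant_of_eq x.toKIdx (by rw [hco, hη, hGb]) ?_)
    exact hasMajorant_diffLetter_inl_mul x.toKIdx b ιB U ν _ (h1 ν)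
  · refine hK (fun a => (geo9Y x).len a) (hasMajorant_of_eq x.toKIdx (by rw [hco, hη, hGb]) ?_)
    exact hasMajorant_mul_diffLetter_inr x.toKIdx b ιB U ν _ (h2 ν)
  · have h := hasMajorant_conj_bondOpCoordsRY x.toKIdx b ιB _ h3
    refine hK (fun _ => (1 : ℝ)) (hasMajorant_of_eq x.toKIdx (T := conj b _) ?_ h)
    rw [hGb, LapBC, decY_base, ← B9Eq352DivFormLetters.conj_mul, ← bondOpCoordsRY_mul]
    rfl

/-- ★★ **FIELD `writeG342` OF THE G FRAME AT NODE 00's LETTERS**: at a (base `U`, multiplier `a`) pair with `U` `G`-valued, r06's four block majorants at the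
product (`GbC (prod U a)`, the left products for the printed `k = inl ν`, the right products for the printed `k = inr ν`, `LapBC (base U) * GbC (prod U a)`;
difference letters and Laplacian at the BASE) with `(B, δ)` give the (3.42) block of `KACU` at the coded product with `(M₂Σ_j‖b_j‖·B, δ)` — gen 12's writer
`writeG342Y_KACU` transported. [cite: Balaban1985BackgroundPropagators, Thm 3.4 p.400 with (3.42) p.397, p.403; Balaban1984PropagatorsII, (2.51) p.232] -/
theorem writeG342_GbC (hι : ∀ s, β x.toKIdx.hN x.toKIdx.D x.toKIdx.hk (ιB s) = s)
    {M₂ : ℝ} (hM₂ : 0 ≤ M₂) (hrepr : ∀ (v : 𝔸) (j : ι), |b.repr v j| ≤ M₂ * ‖v‖) (U : CfgY 𝔸 x.toKIdx) (hUG : GVal G x.toKIdx U)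
    (a : AfldY 𝔸 x.toKIdx) {B δ : ℝ} (hB : 0 ≤ B)
    (h0 : HasMajorant (g := toB6 (geo9Y x) Rr Hp) (fun q : (Fin (d + 1) × SiteY x.toKIdx) × ι => blkC x.toKIdx ιB q.1.2)
      (GbC x.toKIdx parS parB b (.prod U a)) (fun a a' => B * (geo9Y x).len a ^ 2 * Real.exp (-(δ * (geo9Y x).dist a a'))))
    (h1 : ∀ ν : Fin (d + 1), HasMajorant (g := toB6 (geo9Y x) Rr Hp) (fun q : (Fin (d + 1) × SiteY x.toKIdx) × ι => blkC x.toKIdx ιB q.1.2)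
      (conj b (diffLetter (bT (shiftY x.toKIdx)) (bU (coordC G x.toKIdx (.base U))) ((((geo9Y x).eta : ℂ))⁻¹) (Sum.inl ν)) *
        GbC x.toKIdx parS parB b (.prod U a))
      (fun a a' => B * (geo9Y x).len a * Real.exp (-(δ * (geo9Y x).dist a a'))))
    (h2 : ∀ ν : Fin (d + 1), HasMajorant (g := toB6 (geo9Y x) Rr Hp) (fun q : (Fin (d + 1) × SiteY x.toKIdx) × ι => blkC x.toKIdx ιB q.1.2)
      (GbC x.toKIdx parS parB b (.prod U a) *
        conj b (diffLetter (bT (shiftY x.toKIdx)) (bU (coordC G x.toKIdx (.base U))) ((((geo9Y x).eta : ℂ))⁻¹) (Sum.inr ν)))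
      (fun a a' => B * (geo9Y x).len a * Real.exp (-(δ * (geo9Y x).dist a a'))))
    (h3 : HasMajorant (g := toB6 (geo9Y x) Rr Hp) (fun q : (Fin (d + 1) × SiteY x.toKIdx) × ι => blkC x.toKIdx ιB q.1.2)
      (LapBC x.toKIdx b (.base U) * GbC x.toKIdx parS parB b (.prod U a)) (fun a a' => B * 1 * Real.exp (-(δ * (geo9Y x).dist a a')))) :
    EBlock (KACU G x (GAY x.toKIdx parS parB (GpY x.toKIdx parS)) parB C37 C38) (M₂ * (∑ j, ‖b j‖) * B) δ (.prod U a) := by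
  letI : Fintype (geo9K x.toKIdx).Site := ‹Fintype (geo9Y x).Site›
  have hco : coordC G x.toKIdx (.base U) = UboxY x.toKIdx U := coordC_base_eq G x hUG
  have hη : ((((geo9Y x).eta : ℂ)))⁻¹ = ((|x.toKIdx.cf| : ℝ) : ℂ) := eta_inv_eq_abs_cf x.toKIdx
  set W := decY x.toKIdx (.prod U a) with hW
  have hGb := GbC_eq_conj_bondOpCoordsRY x parS parB b (.prod U a)
  refine writeG342Y_KACU (Rr := Rr) (Hp := Hp) b G x (GAY x.toKIdx parS parB (GpY x.toKIdx parS)) parB C37 C38 ιB hι hM₂ hrepr U a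
    ((GAY x.toKIdx parS parB (GpY x.toKIdx parS) W).restrictScalars ℝ) (fun Λ => rfl)
    (fun ν => cdBₗ x.toKIdx U ν) (fun ν => cdsBₗ x.toKIdx U ν) (fun ν Λ => cdBₗ_apply x.toKIdx U ν Λ) (fun ν Λ => cdsBₗ_apply x.toKIdx U ν Λ)
    (lapBₗ x.toKIdx U) (fun Λ => lapBₗ_apply x.toKIdx U Λ) hB ?_ (fun ν => ?_) (fun ν => ?_) ?_
  · exact hasMajorant_conj_of_bondOpCoordsRY x.toKIdx b ιB _ (hasMajorant_of_eq x.toKIdx hGb.symm h0)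
  · refine hasMajorant_cdBₗ_comp_of x.toKIdx b ιB U ν _ (hasMajorant_of_eq x.toKIdx ?_ (h1 ν))
    rw [hco, hη, hGb]
  · refine hasMajorant_comp_cdsBₗ_of x.toKIdx b ιB U ν _ (hasMajorant_of_eq x.toKIdx ?_ (h2 ν))
    rw [hco, hη, hGb]
  · rw [← B9Eq352DivFormLetters.conj_mul]
    refine hasMajorant_conj_of_bondOpCoordsRY x.toKIdx b ιB _ (hasMajorant_of_eq x.toKIdx ?_ h3)
    rw [hGb, LapBC, decY_base, ← B9Eq352DivFormLetters.conj_mul, ← bondOpCoordsRY_mul]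

end Fields

end Literature.MathematicalPhysics.QuantumFieldTheory.Balaban1983to89.B9SectBGReadCodedY

end
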